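import Summits.BirchSwinnertonDyer.BirchSwinnertonDyer.Theorems.PrintX9MuPartOfPrintKSOfHowardIntended
import Summits.BirchSwinnertonDyer.BirchSwinnertonDyer.Theorems.SchneiderFreeAdditiveX3PoitouTateShaDualityHolds
import Summits.BirchSwinnertonDyer.BirchSwinnertonDyer.Theorems.PoitouTateSelmerStructureDualityConjHolds
import Literature.NumberTheory.GaloisCohomology.Howard2004.TowerZModLeftKernelPairingProofs
import Literature.NumberTheory.GaloisCohomology.Howard2004.EngineDecompositionsOfSkewPairingIntendedProofs
import Summits.BirchSwinnertonDyer.BirchSwinnertonDyer.Theses.PrintX9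
import Summits.BirchSwinnertonDyer.BirchSwinnertonDyer.Theses.PrintX10b
import HarnessLib

/-!
# Line `ks_byname` on the shared μ-crux `MuInequalityCoherentPair` (stmt-BirchSwinnertonDyer-22642) —
# RESHAPED CUT v6: ONE STUB = CGLS Thm. 4.1.1 in Kolyvagin-system form (F-411) BY NAME (x9-p1 LEAD g10, 2026-08-29)

Supersedes v5 `flach_byname` (same seat, 13:53Z; stubs `stub_h141` = C45.1″, `stub_h411`). Since then the cell's C451 swarm DISCHARGED C45.1″
in the kernel (bsd-line-x10b-p1 LEAD g14's `Howard2004.prop141_casselsTate_skewPairing_atLevel_printIntended_of_poitouTate`, p729060, modulo the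
tree's theorems `Automorphic.chebotarev_artinRep_of_galoisSide`, `SchneiderFreeAdditiveX3.PoitouTateReduction.poitouTate_sha_tateDual_holds`,
`InputsPoitouTateSelmer.poitouTate_selmerStructure_duality_conj_holds`), whence Howard 2004 Thm. 1.6.1 PRINT-AS-INTENDED is an UNCONDITIONAL kernel
theorem (`DVRSetting.thm161_printIntended_of_prop141_printIntended`, w7 g12 p723075, at that term — applied INLINE below). With this seat's μ-road at F-161′ (`HeegnerMuPartOfHowardIntended.muPartStabilizedCoherentPair_of_howardIntended_thm411
: F-161′ → F-411 → L∃`, p711800) the honest registry reads: «22642 closes modulo EXACTLY ONE cite-only print leaf, F-411 (CGLS 2022 Thm. 4.1.1 KS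
form + Rem. 4.1.4: Howard §1.7/§2.3 KS axioms for Heegner classes + Cornut–Vatsal non-vanishing)». `stub_h411` keeps its v4/v5 name and signature.
Composition concludes both route decls BY NAME; `sorry` only inside `stub_h411`. No summit statement is proved; F-411 is NOT proved; BSD is NOT proved
by any of this.
-/

set_option linter.dupNamespace false
set_option autoImplicit false

namespace Summit.BirchSwinnertonDyer.BirchSwinnertonDyer.Cruxes.MuInequalityCoherentPair.KSByName

open Summit.BirchSwinnertonDyer.BirchSwinnertonDyer.Theorems
open Literature.NumberTheory.GaloisCohomology.Howard2004

/-! ## The one stub (the ONLY sorry of the file) — a cite-only print leaf BY NAME -/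

/-- Stub `stub_h411` — the CITE-ONLY print leaf CGLS 2022 Thm. 4.1.1 in Kolyvagin-system form with Rem. 4.1.4
(`CastellaGrossiLeeSkinner2022.thm411_exists_kolyvaginSystem_one_ne_zero`, F-411); name and signature identical to v4/v5. Not worker-sized (XL).
[cite: CastellaGrossiLeeSkinner2022, Thm. 4.1.1, Rem. 4.1.4 (arXiv:2008.02571 §4.1)] -/
theorem stub_h411 :
    Literature.NumberTheory.EllipticCurves.CastellaGrossiLeeSkinner2022.thm411_exists_kolyvaginSystem_one_ne_zero := by
  sorry

/-! ## Composition (kernel-checked, no `sorry` outside the stub) -/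

/-- **ROW 9 — the crux decl BY NAME from the one stub**: `Theses.PrintX9.MuInequalityCoherentPair` (stmt-BirchSwinnertonDyer-22642) := the μ-road at
the print-as-intended Howard leaf (p711800) fed with Howard Thm. 1.6.1-as-intended as an UNCONDITIONAL kernel term (CLOSING″ p723075 at the
kernel C45.1″ p729060 and the tree's Chebotarev / Poitou–Tate theorems) and `stub_h411`. -/
theorem MuInequalityCoherentPair_of_stubs :
    Summit.BirchSwinnertonDyer.BirchSwinnertonDyer.Theses.PrintX9.MuInequalityCoherentPair :=
  HeegnerMuPartOfHowardIntended.muPartStabilizedCoherentPair_of_howardIntended_thm411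
    (DVRSetting.thm161_printIntended_of_prop141_printIntended
      (prop141_casselsTate_skewPairing_atLevel_printIntended_of_poitouTate
        Literature.NumberTheory.Automorphic.chebotarev_artinRep_of_galoisSide
        (fun K _ _ => SchneiderFreeAdditiveX3.PoitouTateReduction.poitouTate_sha_tateDual_holds K)
        (fun K _ _ => InputsPoitouTateSelmer.poitouTate_selmerStructure_duality_conj_holds K))
      fun K _ _ => InputsPoitouTateSelmer.poitouTate_selmerStructure_duality_conj_holds K)
    stub_h411

/-- **ROW 10 twin — the same item over `Theses.PrintX10b` from the one stub** (identical text). -/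
theorem MuInequalityCoherentPair_of_stubs_X10b :
    Summit.BirchSwinnertonDyer.BirchSwinnertonDyer.Theses.PrintX10b.MuInequalityCoherentPair :=
  MuInequalityCoherentPair_of_stubs

/-- The crux letter L∃ (`HeegnerMuPartStabilized.MuPartStabilizedCoherentPair`) from the one stub. -/
theorem MuPartStabilizedCoherentPair_of_stubs : HeegnerMuPartStabilized.MuPartStabilizedCoherentPair :=
  MuInequalityCoherentPair_of_stubs

end Summit.BirchSwinnertonDyer.BirchSwinnertonDyer.Cruxes.MuInequalityCoherentPair.KSByName
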